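import Mathlib.FieldTheory.Finite.Basic
import Mathlib.Data.Nat.Choose.Sum
import Literature.Computability.MetaComplexity.ModqImmunity
import Literature.Computability.MetaComplexity.HilbertFunctionLowerBound
import Literature.Computability.MetaComplexity.RazborovSmolenskyPoly
import HarnessLib

/-!
# Smolensky's bound for a SINGLE residue indicator under the uniform distribution: a low-degree
# polynomial over `𝔽_p` agrees with `[Σ xᵢ ≡ r (mod q)]` on at most `(1 − 1/q)·2ⁿ + O(D)·C(n, n/2)` points

The uniform-distribution, single-Boolean-output form of the Razborov–Smolensky bound for the `MOD_q`
function, as quoted by Bhowmick–Lovett (CCC 2015, arXiv:1412.4719, p. 2): "If `f : 𝔽₂ⁿ → 𝔽₂` is a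
polynomial of degree `d` then `Pr_x[f(x) = MOD₃(x)] ≤ 2/3 + O(d/√n)`" — i.e. a low-degree polynomial
cannot beat the trivial (constant) approximation of one residue class of the Hamming weight.  The
tree's `SmolenskyCorrelation.lean` has the `ℤ/q`-VALUED form (`modq_agreement_le`: guessing the residue
succeeds on `≤ 2ⁿ⁻¹ + D·C(n,n/2)` points), the character form and PARITY/MAJORITY; the single-indicator
form is not a corollary of those (knowing `[|x| ≡ r]` does not determine `ω^{|x|}`), and is proved here by
Smolensky's 1993 Hilbert-function route:

* `hilbertFn_mono`, `finrank_lowDeg_le_hilbertFn_add_card` — two facts about the affine Hilbert function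
  `h_Y(m) = dim (lowDeg m)|_Y` (`Smolensky.hilbertFn`): monotone in `Y`, and
  `dim lowDeg m ≤ h_Y(m) + |T|` whenever a degree-`≤ m` polynomial vanishing on `Y ∪ T` must vanish
  (rank–nullity);
* `two_mul_sum_choose_add_card_agree_le` (**the bound, exact form**): for a prime `p`, `q > 1` with
  `p ∤ q`, `P ∈ lowDeg 𝔽_p n D` and `2m + (p−1)D < n`:
  `2·Σ_{j≤m} C(n,j) + #{u : P u = [|u| ≡ r (mod q)]} ≤ 2ⁿ + #{u : |u| ≢ r (mod q)}`.
  Proof (Smolensky 1993 / Moran–Rashtchian 2016 Lemma 7.2 = the tree's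
  `two_mul_finrank_restrict_support_le_card`, + Beck–Li immunity `beckLi2013_thm34`): with
  `S = {|u| ≢ r}`, `E = {P ≠ f}` and `B = {P = 0} = supp(1 − P^{p−1})` (degree `(p−1)D`):
  `S ∖ E ⊆ B`, so `h_{S∖E}(m) ≤ h_B(m) ≤ |B|/2` (Smolensky's half bound); a degree-`≤ m` polynomial
  vanishing on `S ∖ E` and on `S ∩ E` is supported in one class, hence zero (immunity, `2m < n`), so
  `dim lowDeg m ≤ h_{S∖E}(m) + |S ∩ E|`; and `|B| ≤ |S ∖ E| + |E ∖ S|`.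
* `card_agree_modIndicator_le` (**explicit form**): with the least admissible `m`,
  `#{u : P u = [|u| ≡ r (mod q)]} ≤ #{u : |u| ≢ r (mod q)} + ((p−1)D + 1)·C(n, ⌊n/2⌋)`; for `p = 2`,
  `q = 3` this is the displayed `(2/3)·2ⁿ + O(D·2ⁿ/√n)`.

WHAT THIS IS NOT: no bound below the trivial `1 − 1/q` (one-class avoidance is a different statement —
cf. the QuantumAdvantage cell qa-qnc0's PLDAMS ladder); the hard-distribution `O(D/√n)`-correlation
form (Viola's survey, ECCC TR22-142, Thm. 2) needs probabilistic-polynomial boosting and is not here.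

## References

* R. Smolensky, *Algebraic methods in the theory of lower bounds for Boolean circuit complexity*,
  STOC 1987 [Smolensky1987]; *On representations by low-degree polynomials*, FOCS 1993 [Smolensky1993].
* S. Moran, C. Rashtchian, *Shattered sets and the Hilbert function*, MFCS 2016, Lemma 7.2
  [MoranRashtchian2016].
* C. Beck, Y. Li, *Represent MOD function by low degree polynomial with unbounded one-sided error*,
  arXiv:1304.0713, Thm. 3.4 [BeckLi2013].
* A. Bhowmick, S. Lovett, *Nonclassical polynomials as a barrier to polynomial lower bounds*, CCC 2015,
  arXiv:1412.4719, p. 2 (the displayed inequality).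
-/

noncomputable section

namespace Literature.Computability.MetaComplexity

namespace Smolensky

open Finset Module

variable {n : ℕ}

section HilbertFn

variable {F : Type*} [Field F]

/-- Pointwise formula for `projOn` (the library's simp lemma is file-private). [folklore] -/
private theorem projOn_apply'' (Y : Finset (Fin n → Bool)) (v : CubeFn F n) (x : Fin n → Bool) :
    projOn F Y v x = if x ∈ Y then v x else 0 :=
  rfl

/-- Restricting to a smaller set factors through restricting to a larger one. [folklore] -/
private theorem projOn_comp_projOn {Y Z : Finset (Fin n → Bool)} (h : Y ⊆ Z) :
    (projOn F Y).comp (projOn F Z) = projOn F Y := by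
  apply LinearMap.ext
  intro v
  funext x
  rw [LinearMap.comp_apply, projOn_apply'', projOn_apply'', projOn_apply'']
  by_cases hx : x ∈ Y
  · rw [if_pos hx, if_pos hx, if_pos (h hx)]
  · rw [if_neg hx, if_neg hx]

/-- **The affine Hilbert function is monotone in the point set:** `h_Y(D) ≤ h_Z(D)` for `Y ⊆ Z`.
[cite: MoranRashtchian2016, Lemma 7.2 (the Hilbert function h_d(C))] -/
theorem hilbertFn_mono {Y Z : Finset (Fin n → Bool)} (h : Y ⊆ Z) (D : ℕ) :
    hilbertFn F Y D ≤ hilbertFn F Z D := by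
  unfold hilbertFn
  rw [← projOn_comp_projOn (F := F) h, Submodule.map_comp]
  exact Submodule.finrank_map_le _ _

/-- **Rank–nullity for restriction:** if every polynomial of degree `≤ m` that vanishes on `Y` and on
`T` is zero, then `dim lowDeg m ≤ h_Y(m) + |T|` (the kernel of restriction to `Y` embeds into the
functions on `T`). [cite: MoranRashtchian2016, Lemma 7.2 (the Hilbert function h_d(C))] -/
theorem finrank_lowDeg_le_hilbertFn_add_card {m : ℕ} (Y T : Finset (Fin n → Bool))
    (hvan : ∀ Q ∈ lowDeg F n m, (∀ y ∈ Y, Q y = 0) → (∀ t ∈ T, Q t = 0) → Q = 0) :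
    finrank F (lowDeg F n m) ≤ hilbertFn F Y m + T.card := by
  classical
  set V : Submodule F (CubeFn F n) := lowDeg F n m with hV
  set f : V →ₗ[F] CubeFn F n := (projOn F Y).comp V.subtype with hf
  have hrn := LinearMap.finrank_range_add_finrank_ker f
  -- the range is the restriction space
  have hrange : finrank F (LinearMap.range f) = hilbertFn F Y m := by
    rw [hf, LinearMap.range_comp, Submodule.range_subtype]
    rfl
  -- the kernel embeds into the functions on `T`
  set g : LinearMap.ker f →ₗ[F] (↥T → F) :=
    { toFun := fun v => fun t => (v.1 : CubeFn F n) t.1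
      map_add' := fun v w => by funext t; rfl
      map_smul' := fun c v => by funext t; rfl } with hg
  have hinj : Function.Injective g := by
    intro v w hvw
    apply Subtype.ext
    apply Subtype.ext
    have hsub : ((v.1 : CubeFn F n) - (w.1 : CubeFn F n)) = 0 := by
      refine hvan _ (V.sub_mem v.1.2 w.1.2) (fun y hy => ?_) (fun t ht => ?_)
      · have hvy : projOn F Y ((v.1 : V) : CubeFn F n) y = (0 : CubeFn F n) y :=
          congrFun (LinearMap.mem_ker.1 v.2) y
        have hwy : projOn F Y ((w.1 : V) : CubeFn F n) y = (0 : CubeFn F n) y :=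
          congrFun (LinearMap.mem_ker.1 w.2) y
        rw [projOn_apply'', if_pos hy, Pi.zero_apply] at hvy hwy
        rw [Pi.sub_apply, hvy, hwy, sub_zero]
      · have := congrFun hvw ⟨t, ht⟩
        simp only [hg, LinearMap.coe_mk, AddHom.coe_mk] at this
        rw [Pi.sub_apply, this, sub_self]
    exact sub_eq_zero.1 hsub
  have hker : finrank F (LinearMap.ker f) ≤ T.card := by
    have h := LinearMap.finrank_le_finrank_of_injective hinj
    rwa [Module.finrank_fintype_fun_eq_card, Fintype.card_coe] at h
  calc finrank F (lowDeg F n m) = finrank F (LinearMap.range f) + finrank F (LinearMap.ker f) := hrn.symm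
    _ ≤ hilbertFn F Y m + T.card := by rw [hrange]; exact Nat.add_le_add_left hker _

end HilbertFn

/-! ### The single-indicator bound over `𝔽_p` -/

variable {p : ℕ} [Fact p.Prime]

/-- The zero set of `P` is the support of `1 − P^{p−1}` (Fermat). [folklore] -/
private theorem one_sub_pow_ne_zero_iff (P : CubeFn (ZMod p) n) (u : Fin n → Bool) :
    (1 - P ^ (p - 1)) u ≠ 0 ↔ P u = 0 := by
  rw [Pi.sub_apply, Pi.one_apply, Pi.pow_apply]
  constructor
  · intro h
    by_contra hne
    exact h (by rw [ZMod.pow_card_sub_one_eq_one hne, sub_self])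
  · intro h
    rw [h, zero_pow (Nat.sub_ne_zero_of_lt (Fact.out : p.Prime).one_lt), sub_zero]
    exact one_ne_zero

/-- **Smolensky's single-indicator bound, exact form.** Let `p` be prime, `q > 1` with `p ∤ q`,
`P : {0,1}ⁿ → 𝔽_p` a polynomial function of degree `≤ D`, `r` a residue, and `2m + (p−1)D < n`.  Then
`2·Σ_{j≤m} C(n,j) + #{u : P u = [|u| ≡ r (mod q)]} ≤ 2ⁿ + #{u : |u| ≢ r (mod q)}`, i.e. the agreement of
`P` with the indicator of one residue class is at most `(1 − 1/q + o(1))·2ⁿ` for `D = o(√n)`.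
[cite: Smolensky1993, the Hilbert-function bound dist(f, deg ≤ D) ≥ 2h_m(Z(f)) − |Z(f)| (as Beck–Li 2013 Thm 7.3); MoranRashtchian2016, Lemma 7.2] -/
theorem two_mul_sum_choose_add_card_agree_le {q : ℕ} (hq : 1 < q) (hpq : ¬ p ∣ q) {D m : ℕ}
    (hmD : 2 * m + (p - 1) * D < n) {P : CubeFn (ZMod p) n} (hP : P ∈ lowDeg (ZMod p) n D) (r : ℕ) :
    2 * ∑ j ∈ range (m + 1), n.choose j +
      (univ.filter fun u : Fin n → Bool =>
        P u = if (univ.filter fun i => u i = true).card % q = r % q then 1 else 0).card ≤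
    2 ^ n + (univ.filter fun u : Fin n → Bool =>
        (univ.filter fun i => u i = true).card % q ≠ r % q).card := by
  classical
  -- abbreviations (as propositions on points)
  set Sp : (Fin n → Bool) → Prop := fun u => (univ.filter fun i => u i = true).card % q ≠ r % q with hSp
  set Ag : (Fin n → Bool) → Prop := fun u =>
    P u = if (univ.filter fun i => u i = true).card % q = r % q then 1 else 0 with hAg
  -- the low-degree support `B = {P = 0}`
  set g : CubeFn (ZMod p) n := 1 - P ^ (p - 1) with hgdef
  have hg : g ∈ lowDeg (ZMod p) n ((p - 1) * D) :=
    Submodule.sub_mem _ (one_mem_lowDeg _) (pow_mem_lowDeg hP (p - 1))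
  set B : Finset (Fin n → Bool) := univ.filter fun u : Fin n → Bool => g u ≠ 0 with hB
  have hmemB : ∀ u, u ∈ B ↔ P u = 0 := fun u => by
    rw [hB, mem_filter, hgdef, one_sub_pow_ne_zero_iff]; simp
  -- (1) Smolensky's half bound on `B`
  have hhalf : 2 * hilbertFn (ZMod p) B m ≤ B.card := by
    rw [hilbertFn_eq_finrank_map_funLeft]
    exact two_mul_finrank_restrict_support_le_card hg hmD
  -- (2) `S ∖ E ⊆ B`
  set SE : Finset (Fin n → Bool) := univ.filter fun u : Fin n → Bool => Sp u ∧ Ag u with hSE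
  set SnE : Finset (Fin n → Bool) := univ.filter fun u : Fin n → Bool => Sp u ∧ ¬ Ag u with hSnE
  have hsub : SE ⊆ B := by
    intro u hu
    rw [hSE, mem_filter] at hu
    rw [hmemB]
    have h2 : Ag u := hu.2.2
    simp only [hAg] at h2
    rw [h2, if_neg hu.2.1]
  have hmono := hilbertFn_mono (F := ZMod p) hsub m
  -- (3) immunity: a degree-`≤ m` polynomial vanishing on `S ∖ E` and `S ∩ E` vanishes on `S`, hence is `0`
  have h2m : 2 * m < n := by omega
  have hdim : finrank (ZMod p) (lowDeg (ZMod p) n m) ≤ hilbertFn (ZMod p) SE m + SnE.card := by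
    refine finrank_lowDeg_le_hilbertFn_add_card SE SnE fun Q hQ h1 h2 => ?_
    refine beckLi2013_thm34 hq hpq h2m hQ r fun b hb => ?_
    by_contra hbS
    by_cases hAb : Ag b
    · exact hb (h1 b (by rw [hSE, mem_filter]; exact ⟨mem_univ _, hbS, hAb⟩))
    · exact hb (h2 b (by rw [hSnE, mem_filter]; exact ⟨mem_univ _, hbS, hAb⟩))
  rw [finrank_lowDeg] at hdim
  -- (4) `|B| ≤ |S ∩ A| + |Sᶜ ∩ Aᶜ|` where `A` = agreement set
  set nSnA : Finset (Fin n → Bool) := univ.filter fun u : Fin n → Bool => ¬ Sp u ∧ ¬ Ag u with hnSnA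
  set nSA : Finset (Fin n → Bool) := univ.filter fun u : Fin n → Bool => ¬ Sp u ∧ Ag u with hnSA
  have hBsub : B ⊆ SE ∪ nSnA := by
    intro u hu
    rw [hmemB] at hu
    rw [mem_union, hSE, hnSnA, mem_filter, mem_filter]
    by_cases hS : Sp u
    · left
      refine ⟨mem_univ _, hS, ?_⟩
      show P u = _
      rw [hu, if_neg hS]
    · right
      refine ⟨mem_univ _, hS, fun hA => ?_⟩
      have hA' : P u = _ := hA
      rw [hu, if_pos (not_not.1 hS)] at hA'
      exact zero_ne_one hA'
  have hBcard : B.card ≤ SE.card + nSnA.card := (card_le_card hBsub).trans (card_union_le _ _)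
  -- (5) the four cells partition the cube
  have hS_split : (univ.filter fun u : Fin n → Bool => Sp u).card = SE.card + SnE.card := by
    rw [hSE, hSnE, ← card_filter_add_card_filter_not (s := univ.filter fun u : Fin n → Bool => Sp u) Ag,
      filter_filter, filter_filter]
  have hnS_split : (univ.filter fun u : Fin n → Bool => ¬ Sp u).card = nSA.card + nSnA.card := by
    rw [hnSA, hnSnA, ← card_filter_add_card_filter_not (s := univ.filter fun u : Fin n → Bool => ¬ Sp u) Ag,
      filter_filter, filter_filter]
  have hA_split : (univ.filter fun u : Fin n → Bool => Ag u).card = nSA.card + SE.card := by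
    rw [hnSA, hSE, ← card_filter_add_card_filter_not (s := univ.filter fun u : Fin n → Bool => Ag u)
      (fun u => ¬ Sp u), filter_filter, filter_filter]
    congr 1
    · exact congrArg _ (filter_congr fun u _ => by tauto)
    · exact congrArg _ (filter_congr fun u _ => by tauto)
  have htot : (univ.filter fun u : Fin n → Bool => Sp u).card +
      (univ.filter fun u : Fin n → Bool => ¬ Sp u).card = 2 ^ n := by
    rw [card_filter_add_card_filter_not, card_univ, Fintype.card_fun, Fintype.card_bool, Fintype.card_fin]
  -- assemble
  have hAg_eq : (univ.filter fun u : Fin n → Bool =>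
      P u = if (univ.filter fun i => u i = true).card % q = r % q then 1 else 0) =
      univ.filter fun u : Fin n → Bool => Ag u := rfl
  have hSp_eq : (univ.filter fun u : Fin n → Bool =>
      (univ.filter fun i => u i = true).card % q ≠ r % q) = univ.filter fun u : Fin n → Bool => Sp u := rfl
  rw [hAg_eq, hSp_eq]
  omega

/-- The central binomial sum from below: for `2m + e < n ≤ 2m + e + 2`,
`2ⁿ ≤ 2·Σ_{j≤m} C(n,j) + (e+1)·C(n, ⌊n/2⌋)`. [folklore] -/
private theorem two_pow_le_two_mul_sum_choose_add {m e : ℕ} (h1 : 2 * m + e < n) (h2 : n ≤ 2 * m + e + 2) :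
    2 ^ n ≤ 2 * ∑ j ∈ range (m + 1), n.choose j + (e + 1) * n.choose (n / 2) := by
  -- split `Σ_{j ≤ n} C(n,j)` at `m + 1` and at `n − m`
  have hsum := Nat.sum_range_choose n
  have hmn : m + 1 ≤ n - m := by omega
  have hnm : n - m ≤ n + 1 := by omega
  rw [← Finset.sum_range_add_sum_Ico _ (show m + 1 ≤ n + 1 by omega),
    ← Finset.sum_Ico_consecutive _ hmn hnm] at hsum
  -- the top part equals the bottom part by symmetry
  have htop : ∑ j ∈ Ico (n - m) (n + 1), n.choose j = ∑ j ∈ range (m + 1), n.choose j := by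
    rw [Finset.sum_Ico_eq_sum_range, show n + 1 - (n - m) = m + 1 by omega]
    have hrefl : ∑ j ∈ range (m + 1), n.choose j =
        ∑ j ∈ range (m + 1), n.choose (m + 1 - 1 - j) :=
      (Finset.sum_range_reflect (fun j => n.choose j) (m + 1)).symm
    rw [hrefl]
    refine Finset.sum_congr rfl fun k hk => ?_
    rw [Finset.mem_range] at hk
    rw [show m + 1 - 1 - k = m - k by omega, show n - m + k = n - (m - k) by omega,
      Nat.choose_symm (by omega : m - k ≤ n)]
  -- the middle part has `n − 2m − 1 ≤ e + 1` terms, each `≤ C(n, n/2)`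
  have hmid : ∑ j ∈ Ico (m + 1) (n - m), n.choose j ≤ (e + 1) * n.choose (n / 2) :=
    calc ∑ j ∈ Ico (m + 1) (n - m), n.choose j ≤ ∑ _j ∈ Ico (m + 1) (n - m), n.choose (n / 2) :=
          Finset.sum_le_sum fun j _ => Nat.choose_le_middle j n
      _ = (n - m - (m + 1)) * n.choose (n / 2) := by rw [Finset.sum_const, Nat.card_Ico, smul_eq_mul]
      _ ≤ (e + 1) * n.choose (n / 2) := Nat.mul_le_mul_right _ (by omega)
  omega

/-- **Smolensky's single-indicator bound, explicit form:** for a prime `p`, `q > 1` with `p ∤ q`,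
`(p−1)D < n` and `P ∈ lowDeg 𝔽_p n D`, the number of points where `P` agrees with the indicator of the
class `|u| ≡ r (mod q)` is at most `#{u : |u| ≢ r (mod q)} + ((p−1)D + 1)·C(n, ⌊n/2⌋)` — the trivial
agreement plus `O(D·2ⁿ/√n)`; for `p = 2`, `q = 3`: `Pr_x[P(x) = MOD₃-class(x)] ≤ 2/3 + O(D/√n)`.
[cite: Smolensky1987, Thm. 2 (proof); Smolensky1993; as displayed in Bhowmick–Lovett 2015, p. 2] -/
theorem card_agree_modIndicator_le {q : ℕ} (hq : 1 < q) (hpq : ¬ p ∣ q) {D : ℕ}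
    (hDn : (p - 1) * D < n) {P : CubeFn (ZMod p) n} (hP : P ∈ lowDeg (ZMod p) n D) (r : ℕ) :
    (univ.filter fun u : Fin n → Bool =>
        P u = if (univ.filter fun i => u i = true).card % q = r % q then 1 else 0).card ≤
      (univ.filter fun u : Fin n → Bool =>
        (univ.filter fun i => u i = true).card % q ≠ r % q).card + ((p - 1) * D + 1) * n.choose (n / 2) := by
  -- the largest `m` with `2m + (p−1)D < n`
  set e := (p - 1) * D with he
  set m := (n - e - 1) / 2 with hm
  have h1 : 2 * m + e < n := by omega
  have h2 : n ≤ 2 * m + e + 2 := by omega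
  have hmain := two_mul_sum_choose_add_card_agree_le hq hpq h1 hP r
  have hbin := two_pow_le_two_mul_sum_choose_add h1 h2
  omega

end Smolensky

end Literature.Computability.MetaComplexity
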